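import Summits.RiemannHypothesis.RiemannHypothesis.Theses.SignCone
import Summits.RiemannHypothesis.RiemannHypothesis.Theorems.SignConeFarField.Negative.BumpAutocorrelation
import Literature.NumberTheory.LFunctions.WeilExplicitArchTermProofs
import Literature.NumberTheory.LFunctions.WeilMellinBounds
import Mathlib.Analysis.SpecialFunctions.Trigonometric.DerivHyp
import HarnessLib

/-!
# `SignConeFarField` — negative lemma: the origin must dominate

Refuter (crux disprover) record for the crux `stmt-RiemannHypothesis-16305`
(`Summit.RiemannHypothesis.RiemannHypothesis.Theses.SignCone.SignConeFarField`). The crux asserts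
`-Re F(0) ≤ Re W_ar(F)` (`W_ar = weilPolarTerm + weilArchTerm`) for node- and far-field-nonnegative
autocorrelation sums `F = Σᵢ gᵢ ⋆ g̃ᵢ`. Which part of "`F` is an autocorrelation sum" does a proof need?

`signConeFarField_false_without_PD_nonneg`: replace "`F = Σᵢ gᵢ ⋆ g̃ᵢ`" by "`F` smooth, compactly
supported in `[-2a, 2a]`, HERMITIAN (`F(-t) = conj F(t)`) and NON-NEGATIVE EVERYWHERE (`Re F ≥ 0`, which
contains both sign hypotheses of the crux)" — the statement becomes FALSE. So smoothness, support,
hermitian symmetry and all sign information together do not suffice: the proof must use that the ORIGIN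
DOMINATES, `|F(t)| ≤ Re F(0)` (the consequence of positive-definiteness the route's bookkeeping uses).

Witness: `F₀(t) = Γ(t - 7/50) + Γ(t + 7/50)` with `Γ = b ⋆ b` the autocorrelation of the smooth bump `b` of
radius `1/20` (`Negative/BumpAutocorrelation.lean`: `Γ ≥ 0`, even, `supp Γ ⊆ [-1/10, 1/10]`), i.e. two positive bumps at `±7/50` and NOTHING
at the origin: `F₀(0) = 0`, `F₀ ≥ 0`, `supp F₀ ⊆ ±[1/25, 6/25]`. By Bombieri's form of the archimedean term
(`weilArchTermBombieri_eq_weilArchTerm_holds`) and `F₀(0) = 0`,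
`W_ar(F₀) = ∫ Γ(t - 7/50) K(t) dt`, `K(t) = 2(e^{-t/2} + e^{t/2}) - e^{t/2}/sinh t = 2w(t)`,
and `K ≤ -1/5` on `(0, 6/25]` (elementary: with `x = e^{t/2} ≤ e^{3/25} ≤ 25/22` it reduces to
`(10x² + x)(x⁴ - 1) ≤ 10`; the sign change of `K` is at `t_w = 0.2812`, `e^{t_w}` the plastic number),
whence `Re W_ar(F₀) ≤ -(1/5) ∫ Γ < 0 = -Re F₀(0)`.

Main results: `re_weilArchPolar_witness_neg`, `signConeFarField_false_without_PD_nonneg`. The bump, `Γ`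
and the profile `f₀` with their elementary properties are in `Negative/BumpAutocorrelation.lean`.
-/

set_option linter.dupNamespace false

noncomputable section

open scoped BigOperators ComplexConjugate
open Complex MeasureTheory Set Filter

namespace Summit.RiemannHypothesis.RiemannHypothesis.Theorems.SignConeFarField.Negative

open Literature.NumberTheory.LFunctions
open Summit.RiemannHypothesis.RiemannHypothesis.Theses.SignCone

/-! ## `W_ar(F₀)` in closed form -/

/-- The shifted copy `t ↦ Γ(t - 7/50)` has compact support. [folklore] -/
theorem hasCompactSupport_gam_shift : HasCompactSupport fun t : ℝ => gam (t - 7 / 50) := by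
  refine HasCompactSupport.intro (isCompact_Icc : IsCompact (Icc (1 / 25 : ℝ) (6 / 25))) fun x hx => ?_
  rw [mem_Icc, not_and_or, not_le, not_le] at hx
  rcases hx with h | h
  · exact gam_shift_eq_zero_of_le h.le
  · exact gam_shift_eq_zero_of_ge h.le

/-- Integrability of the polar integrand `Γ(t - 7/50)(e^{-t/2} + e^{t/2})`. [folklore] -/
theorem integrable_polar :
    Integrable fun t : ℝ => gam (t - 7 / 50) * (Real.exp (-(t / 2)) + Real.exp (t / 2)) := by
  have hc : Continuous fun t : ℝ => gam (t - 7 / 50) * (Real.exp (-(t / 2)) + Real.exp (t / 2)) :=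
    (continuous_gam.comp (continuous_id.sub continuous_const)).mul (by fun_prop)
  exact hc.integrable_of_hasCompactSupport hasCompactSupport_gam_shift.mul_right

/-- Integrability of the archimedean integrand `e^{t/2} Γ(t - 7/50)/sinh t` (it lives on `[1/25, 6/25]`,
away from the zero of `sinh`). [folklore] -/
theorem integrable_arch :
    Integrable fun t : ℝ => Real.exp (t / 2) * gam (t - 7 / 50) / Real.sinh t := by
  have hsupp : Function.support (fun t : ℝ => Real.exp (t / 2) * gam (t - 7 / 50) / Real.sinh t) ⊆
      Icc (1 / 25) (6 / 25) := by
    intro t ht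
    rw [Function.mem_support] at ht
    by_contra hn
    rw [mem_Icc, not_and_or, not_le, not_le] at hn
    apply ht
    rcases hn with h | h
    · rw [gam_shift_eq_zero_of_le h.le, mul_zero, zero_div]
    · rw [gam_shift_eq_zero_of_ge h.le, mul_zero, zero_div]
  have hcont : ContinuousOn (fun t : ℝ => Real.exp (t / 2) * gam (t - 7 / 50) / Real.sinh t)
      (Icc (1 / 25) (6 / 25)) := by
    have hnum : Continuous fun t : ℝ => Real.exp (t / 2) * gam (t - 7 / 50) :=
      (by fun_prop : Continuous fun t : ℝ => Real.exp (t / 2)).mul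
        (continuous_gam.comp (continuous_id.sub continuous_const))
    refine hnum.continuousOn.div Real.continuous_sinh.continuousOn fun t ht => ?_
    exact (Real.sinh_pos_iff.2 (by linarith [ht.1])).ne'
  exact (integrableOn_iff_integrable_of_support_subset hsupp).1 (hcont.integrableOn_compact isCompact_Icc)

/-- **Polar term of the witness**: `ĝ(0) + ĝ(1) = 2 ∫ Γ(t - 7/50)(e^{-t/2} + e^{t/2}) dt` (the left copy
contributes the same as the right one, by `t ↦ -t`). [folklore] -/
theorem weilPolarTerm_witness :
    weilPolarTerm (fun t : ℝ => ((f0 t : ℝ) : ℂ)) =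
      ((2 * ∫ t : ℝ, gam (t - 7 / 50) * (Real.exp (-(t / 2)) + Real.exp (t / 2)) : ℝ) : ℂ) := by
  have h1 : weilMellin (fun t : ℝ => ((f0 t : ℝ) : ℂ)) 0 = ((∫ t : ℝ, f0 t * Real.exp (-(t / 2)) : ℝ) : ℂ) := by
    rw [weilMellin, ← integral_complex_ofReal]
    refine integral_congr_ae (Eventually.of_forall fun t => ?_)
    dsimp only
    rw [Complex.ofReal_mul, Complex.ofReal_exp]
    congr 2
    push_cast
    ring
  have h2 : weilMellin (fun t : ℝ => ((f0 t : ℝ) : ℂ)) 1 = ((∫ t : ℝ, f0 t * Real.exp (t / 2) : ℝ) : ℂ) := by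
    rw [weilMellin, ← integral_complex_ofReal]
    refine integral_congr_ae (Eventually.of_forall fun t => ?_)
    dsimp only
    rw [Complex.ofReal_mul, Complex.ofReal_exp]
    congr 2
    push_cast
    ring
  -- integrability of the two real integrands
  have hcf : Continuous f0 :=
    (continuous_gam.comp (continuous_id.sub continuous_const)).add
      (continuous_gam.comp (continuous_id.add continuous_const))
  have hsf : HasCompactSupport f0 := by
    refine HasCompactSupport.intro (isCompact_Icc : IsCompact (Icc (-(1 / 4 : ℝ)) (1 / 4))) fun x hx => ?_
    rw [mem_Icc, not_and_or, not_le, not_le] at hx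
    refine f0_eq_zero_of_le_abs ?_
    rcases hx with h | h
    · rw [abs_of_neg (by linarith)]
      linarith
    · rw [abs_of_pos (by linarith)]
      linarith
  have hi1 : Integrable fun t : ℝ => f0 t * Real.exp (-(t / 2)) :=
    (hcf.mul (by fun_prop)).integrable_of_hasCompactSupport hsf.mul_right
  have hi2 : Integrable fun t : ℝ => f0 t * Real.exp (t / 2) :=
    (hcf.mul (by fun_prop)).integrable_of_hasCompactSupport hsf.mul_right
  -- the left copy contributes the same as the right copy
  have hsym : ∫ t : ℝ, gam (t + 7 / 50) * (Real.exp (-(t / 2)) + Real.exp (t / 2)) =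
      ∫ t : ℝ, gam (t - 7 / 50) * (Real.exp (-(t / 2)) + Real.exp (t / 2)) := by
    rw [← integral_neg_eq_self (fun t : ℝ => gam (t + 7 / 50) * (Real.exp (-(t / 2)) + Real.exp (t / 2)))]
    refine integral_congr_ae (Eventually.of_forall fun t => ?_)
    dsimp only
    rw [show -t + 7 / 50 = -(t - 7 / 50) by ring, gam_neg, neg_div, neg_neg, add_comm (Real.exp (t / 2))]
  rw [weilPolarTerm, h1, h2, ← Complex.ofReal_add, ← integral_add hi1 hi2]
  congr 1
  have e : (fun t : ℝ => f0 t * Real.exp (-(t / 2)) + f0 t * Real.exp (t / 2)) =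
      fun t : ℝ => gam (t - 7 / 50) * (Real.exp (-(t / 2)) + Real.exp (t / 2)) +
        gam (t + 7 / 50) * (Real.exp (-(t / 2)) + Real.exp (t / 2)) := by
    funext t
    simp only [f0]
    ring
  have hi3 : Integrable fun t : ℝ => gam (t + 7 / 50) * (Real.exp (-(t / 2)) + Real.exp (t / 2)) := by
    have hc : Continuous fun t : ℝ => gam (t + 7 / 50) * (Real.exp (-(t / 2)) + Real.exp (t / 2)) :=
      (continuous_gam.comp (continuous_id.add continuous_const)).mul (by fun_prop)
    refine hc.integrable_of_hasCompactSupport (HasCompactSupport.mul_right ?_)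
    refine HasCompactSupport.intro (isCompact_Icc : IsCompact (Icc (-(6 / 25) : ℝ) (-(1 / 25)))) fun x hx => ?_
    rw [mem_Icc, not_and_or, not_le, not_le] at hx
    rcases hx with h | h
    · refine gam_eq_zero ?_
      rw [abs_of_neg (by linarith)]
      linarith
    · exact gam_shift'_eq_zero_of_ge h.le
  rw [e, integral_add integrable_polar hi3, hsym]
  ring

/-- **Archimedean term of the witness** (Bombieri's form, `F₀(0) = 0`, `F₀` even, only the right copy on
`t > 0`): `W_∞(F₀) = -∫ e^{t/2} Γ(t - 7/50)/sinh t dt`. [folklore] -/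
theorem weilArchTerm_witness :
    weilArchTerm (fun t : ℝ => ((f0 t : ℝ) : ℂ)) =
      -(((∫ t : ℝ, Real.exp (t / 2) * gam (t - 7 / 50) / Real.sinh t : ℝ) : ℂ)) := by
  rw [← weilArchTermBombieri_eq_weilArchTerm_holds isWeilTest_witness, weilArchTermBombieri]
  have h0 : ((f0 0 : ℝ) : ℂ) = 0 := by rw [f0_zero, Complex.ofReal_zero]
  simp only [h0, mul_zero, zero_add, sub_zero]
  congr 1
  have hpt : EqOn (fun t : ℝ => (Real.exp (t / 2) : ℂ) * (((f0 t : ℝ) : ℂ) + ((f0 (-t) : ℝ) : ℂ)) /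
      (2 * (Real.sinh t : ℂ)))
      (fun t : ℝ => ((Real.exp (t / 2) * gam (t - 7 / 50) / Real.sinh t : ℝ) : ℂ)) (Ioi 0) := by
    intro t ht
    have hf : f0 t + f0 (-t) = 2 * gam (t - 7 / 50) := by
      rw [f0_neg, f0_of_pos ht]
      ring
    dsimp only
    rw [← Complex.ofReal_add, hf]
    push_cast
    ring
  rw [setIntegral_congr_fun measurableSet_Ioi hpt,
    setIntegral_eq_integral_of_forall_compl_eq_zero fun t ht => ?_, integral_complex_ofReal]
  rw [mem_Ioi, not_lt] at ht
  rw [gam_shift_eq_zero_of_le (by linarith), mul_zero, zero_div, Complex.ofReal_zero]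

/-! ## The kernel is negative near the origin -/

/-- **The weight `K(t) = 2(e^{-t/2} + e^{t/2}) - e^{t/2}/sinh t` is `≤ -1/5` on `(0, 6/25]`.**
With `x = e^{t/2} ∈ (1, 25/22]` (`e^{3/25} ≤ 1/(1 - 3/25)`), `e^{-t/2} = x⁻¹` and
`sinh t = (x² - x⁻²)/2`, the claim is `(10 + 10x² + x)(x⁴ - 1) ≤ 10x⁴`, i.e.
`(10x² + x)(x⁴ - 1) ≤ 10`, and `(10x² + x)(x⁴ - 1) ≤ (10X² + X)(X⁴ - 1) < 9.4` for `X = 25/22`.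
(The sign change of `K` is at `t_w = 0.2812`, `e^{t_w}` the real root of `y³ = y + 1`.) [folklore] -/
theorem kernel_le {t : ℝ} (ht0 : 0 < t) (ht : t ≤ 6 / 25) :
    2 * (Real.exp (-(t / 2)) + Real.exp (t / 2)) - Real.exp (t / 2) / Real.sinh t ≤ -(1 / 5) := by
  set x : ℝ := Real.exp (t / 2) with hx
  have hx0 : 0 < x := Real.exp_pos _
  have hx1 : 1 < x := Real.one_lt_exp_iff.2 (by linarith)
  have hxX : x ≤ 25 / 22 := by
    have h1 : Real.exp (t / 2) ≤ Real.exp (3 / 25) := Real.exp_le_exp.2 (by linarith)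
    have h2 : Real.exp (3 / 25) ≤ 1 / (1 - 3 / 25) :=
      Real.exp_bound_div_one_sub_of_interval (by norm_num) (by norm_num)
    calc x ≤ 1 / (1 - 3 / 25) := h1.trans h2
      _ = 25 / 22 := by norm_num
  have hneg : Real.exp (-(t / 2)) = x⁻¹ := by rw [Real.exp_neg]
  have hexp : Real.exp t = x ^ 2 := by
    rw [hx, sq, ← Real.exp_add, add_halves]
  have hsinh : Real.sinh t = (x ^ 2 - (x ^ 2)⁻¹) / 2 := by
    rw [Real.sinh_eq, Real.exp_neg, hexp]
  rw [hneg, hsinh]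
  have hx4 : 1 < x ^ 4 := one_lt_pow₀ hx1 (by norm_num)
  have hs : 0 < (x ^ 2 - (x ^ 2)⁻¹) / 2 := by
    have h2 : 1 < x ^ 2 := one_lt_pow₀ hx1 (by norm_num)
    have : (x ^ 2)⁻¹ < 1 := inv_lt_one_of_one_lt₀ h2
    linarith
  -- the polynomial inequality
  have h10 : (10 * x ^ 2 + x) * (x ^ 4 - 1) ≤ 10 := by
    have hA : 10 * x ^ 2 + x ≤ 10 * (25 / 22) ^ 2 + 25 / 22 := by nlinarith
    have hB : x ^ 4 - 1 ≤ (25 / 22 : ℝ) ^ 4 - 1 := by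
      have := pow_le_pow_left₀ hx0.le hxX 4
      linarith
    have hB0 : 0 ≤ x ^ 4 - 1 := by linarith
    calc (10 * x ^ 2 + x) * (x ^ 4 - 1) ≤ (10 * (25 / 22) ^ 2 + 25 / 22) * ((25 / 22 : ℝ) ^ 4 - 1) :=
          mul_le_mul hA hB hB0 (by positivity)
      _ ≤ 10 := by norm_num
  have key : 2 * (x⁻¹ + x) + 1 / 5 ≤ x / ((x ^ 2 - (x ^ 2)⁻¹) / 2) := by
    rw [le_div_iff₀ hs]
    have e1 : (2 * (x⁻¹ + x) + 1 / 5) * ((x ^ 2 - (x ^ 2)⁻¹) / 2) =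
        (10 + 10 * x ^ 2 + x) * (x ^ 4 - 1) / (10 * x ^ 3) := by
      field_simp
      ring
    rw [e1, div_le_iff₀ (by positivity)]
    nlinarith [h10]
  linarith

/-! ## The witness violates the inequality -/

/-- **`Re W_ar(F₀) < 0`**: `W_ar(F₀) = ∫ Γ(t - 7/50) K(t) dt ≤ -(1/5) ∫ Γ < 0`. [folklore] -/
theorem re_weilArchPolar_witness_neg :
    (weilPolarTerm (fun t : ℝ => ((f0 t : ℝ) : ℂ)) + weilArchTerm (fun t : ℝ => ((f0 t : ℝ) : ℂ))).re < 0 := by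
  rw [weilPolarTerm_witness, weilArchTerm_witness, ← Complex.ofReal_neg, ← Complex.ofReal_add,
    Complex.ofReal_re]
  set A : ℝ := ∫ t : ℝ, gam (t - 7 / 50) * (Real.exp (-(t / 2)) + Real.exp (t / 2)) with hA
  set B : ℝ := ∫ t : ℝ, Real.exp (t / 2) * gam (t - 7 / 50) / Real.sinh t with hB
  have hcomb : 2 * A - B = ∫ t : ℝ, gam (t - 7 / 50) *
      (2 * (Real.exp (-(t / 2)) + Real.exp (t / 2)) - Real.exp (t / 2) / Real.sinh t) := by
    rw [hA, hB, ← integral_const_mul, ← integral_sub (integrable_polar.const_mul 2) integrable_arch]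
    refine integral_congr_ae (Eventually.of_forall fun t => ?_)
    dsimp only
    ring
  have hI : Integrable fun t : ℝ => gam (t - 7 / 50) *
      (2 * (Real.exp (-(t / 2)) + Real.exp (t / 2)) - Real.exp (t / 2) / Real.sinh t) := by
    refine ((integrable_polar.const_mul 2).sub integrable_arch).congr (Eventually.of_forall fun t => ?_)
    simp only [Pi.sub_apply]
    ring
  have hgi : Integrable fun t : ℝ => gam (t - 7 / 50) :=
    (continuous_gam.comp (continuous_id.sub continuous_const)).integrable_of_hasCompactSupport
      hasCompactSupport_gam_shift
  have hle : ∫ t : ℝ, gam (t - 7 / 50) *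
      (2 * (Real.exp (-(t / 2)) + Real.exp (t / 2)) - Real.exp (t / 2) / Real.sinh t) ≤
      ∫ t : ℝ, -(1 / 5) * gam (t - 7 / 50) := by
    refine integral_mono hI (hgi.const_mul _) fun t => ?_
    dsimp only
    by_cases hg : gam (t - 7 / 50) = 0
    · simp [hg]
    · have ht1 : 1 / 25 < t := by
        by_contra h
        exact hg (gam_shift_eq_zero_of_le (not_lt.1 h))
      have ht2 : t < 6 / 25 := by
        by_contra h
        exact hg (gam_shift_eq_zero_of_ge (not_lt.1 h))
      have hk := kernel_le (by linarith) ht2.le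
      have hg0 : 0 ≤ gam (t - 7 / 50) := gam_nonneg _
      nlinarith [mul_le_mul_of_nonneg_left hk hg0]
  have hint : ∫ t : ℝ, -(1 / 5) * gam (t - 7 / 50) = -(1 / 5) * ∫ t : ℝ, gam t := by
    rw [integral_const_mul, integral_sub_right_eq_self (fun t : ℝ => gam t) (7 / 50)]
  have hpos := integral_gam_pos
  have h2AB : 2 * A + -B < 0 := by linarith
  exact h2AB

/-- **The origin must dominate: `SignConeFarField` without positive-definiteness is FALSE even for
hermitian, everywhere non-negative `F`.** Replacing "`F = Σᵢ gᵢ ⋆ g̃ᵢ`" in the crux by "`F` smooth,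
compactly supported in `[-2a, 2a]`, `F(-t) = conj F(t)`, `Re F ≥ 0` everywhere" (so both sign hypotheses
of the crux hold with room) and keeping the conclusion verbatim gives a false statement: at `a = 1` the
witness `F₀ = Γ(· - 7/50) + Γ(· + 7/50)` has `F₀(0) = 0` but `Re W_ar(F₀) < 0`
(`re_weilArchPolar_witness_neg`). Hence any proof of the crux must use `|F(t)| ≤ Re F(0)` (or more of
positive-definiteness); the far-field sign, the node sign, smoothness, support and hermitian symmetry do
not suffice. [folklore] -/
theorem signConeFarField_false_without_PD_nonneg :
    ¬ (∀ a : ℝ, 0 < a → ∀ F : ℝ → ℂ, (ContDiff ℝ ((⊤ : ℕ∞) : WithTop ℕ∞) F ∧ HasCompactSupport F) ∧ tsupport F ⊆ Set.Icc (-(2 * a)) (2 * a) → (∀ t : ℝ, F (-t) = (starRingEnd ℂ) (F t)) → (∀ t : ℝ, 0 ≤ (F t).re) → let M : ℂ → ℂ := fun s => ∫ u : ℝ, F u * Complex.exp ((s - 1 / 2) * u); -(F 0).re ≤ (M 0 + M 1 + ((1 / (2 * Real.pi) : ℂ) * (∫ t : ℝ, M (1 / 2 + t * Complex.I) * ((Complex.digamma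 (1 / 4 + t / 2 * Complex.I)).re : ℂ)) - F 0 * (Real.log Real.pi : ℂ))).re) := by
  intro h
  have hherm : ∀ t : ℝ, (fun t : ℝ => ((f0 t : ℝ) : ℂ)) (-t) = (starRingEnd ℂ) ((fun t : ℝ => ((f0 t : ℝ) : ℂ)) t) := by
    intro t
    simp only [f0_neg, Complex.conj_ofReal]
  have hnn : ∀ t : ℝ, 0 ≤ ((fun t : ℝ => ((f0 t : ℝ) : ℂ)) t).re := fun t => by
    simp only [Complex.ofReal_re]
    exact f0_nonneg t
  have key : -((fun t : ℝ => ((f0 t : ℝ) : ℂ)) 0).re ≤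
      (weilPolarTerm (fun t : ℝ => ((f0 t : ℝ) : ℂ)) + weilArchTerm (fun t : ℝ => ((f0 t : ℝ) : ℂ))).re :=
    h 1 one_pos _ ⟨isWeilTest_witness, tsupport_witness_subset⟩ hherm hnn
  have h0 : ((fun t : ℝ => ((f0 t : ℝ) : ℂ)) 0).re = 0 := by simp [f0_zero]
  rw [h0, neg_zero] at key
  exact absurd key (not_le.2 re_weilArchPolar_witness_neg)

end Summit.RiemannHypothesis.RiemannHypothesis.Theorems.SignConeFarField.Negative

end
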